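import Mathlib.NumberTheory.NumberField.Basic
import Mathlib.RingTheory.DedekindDomain.AdicValuation
import Mathlib.Algebra.Field.ZMod
import HarnessLib

/-!
# `2`-descent at a split prime above `2`: reduction modulo `8` and the local image of `480a1`

Let `K` be a number field and `ρ : 𝓞 K → ℤ/8` a ring homomorphism. Then `𝔭 = ker(ρ mod 2)` is a
prime of `𝓞 K` of residue field `𝔽₂` in which `2` is a uniformiser (`ord_𝔭(2) = 1`: `𝔭² ⊆ ρ⁻¹(4)` and
`ρ(2) = 2`), i.e. an unramified prime of degree one above `2`, `K_𝔭 = ℚ₂`, and `ρ` is the reduction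
`𝓞 K → 𝓞 K/𝔭³ = ℤ/8`. This file develops, WITHOUT completions, the `𝔭`-adic bookkeeping needed for a
`2`-descent at such a prime:

* `LocI ρ z r` / `LocU ρ z r`: `z ∈ K` is `𝔭`-integral / a `𝔭`-unit with residue `r = z mod 8`
  (`z · s = u` with `s ∉ 𝔭`, `r = ρ(u s)`; residues are unique, additive and multiplicative, odd for
  units);
* `LocQ ρ z n r`: `z = 2ⁿ · (𝔭-unit of residue r)`, i.e. the class of `z` in
  `ℚ₂ˣ ⊇ K ∖ {0}` is `(n, r) ∈ ℤ × (ℤ/8)ˣ`; every `z ≠ 0` has such a description (`exists_locQ`), it is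
  unique (`LocQ.unique`), multiplicative, and `ord_𝔭(z) = n` (`LocQ.valuation_eq`);
* **the local image at `𝔭` of the `2`-descent map of `E = 480a1 : y² = x(x + 2)(x - 3)`**
  (`localImage`): for a `K`-point `(x, y)`, `y ≠ 0`, with `x = α A²`, `x + 2 = β B²`, the classes of
  `α, β` in `ℚ₂ˣ/ℚ₂ˣ² = {(n mod 2, r mod 8)}` lie in the `8`-element set
  `W = {(0,1;0,1), (0,3;0,5), (0,5;0,5), (0,7;0,1), (1,1;1,5), (1,3;1,1), (1,5;1,1), (1,7;1,5)}` (`W480`),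
  which is the image of `E(ℚ₂)/2E(ℚ₂)` (order `2 · #E(ℚ₂)[2]/… = 8`). The proof is the textbook case
  analysis on `n = ord_𝔭(x)` (`n < 0` even; `n = 0`; `n = 1`; `n ≥ 3` odd) using only
  `(x + 2) - x = 2`, `x - (x - 3) = 3` and residues modulo `8`.

This is used for the cyclic cubic field of conductor `1339` in which `2` splits completely
(`CyclicCubicField1339ADescent.lean`), the last of the four `2`-descents behind
`Literature.Barriers.BirchSwinnertonDyer.DokchitserDokchitser2011_rank_480a1_F3`. Everything here is
proved; no named facts are introduced.

## References

* J. H. Silverman, *The Arithmetic of Elliptic Curves*, 2nd ed., GTM 106 (2009): Prop. X.1.4 and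
  §X.1 (computation of the local images of the `2`-descent map). [cite: SilvermanAEC2009, Prop. X.1.4]
* J. W. S. Cassels, *Lectures on Elliptic Curves*, LMS Student Texts 24 (1991), §15 (local images
  at `p = 2`, `|E(ℚ₂)/2E(ℚ₂)| = 2 · |E(ℚ₂)[2]|`). [folklore]
-/

noncomputable section

open NumberField IsDedekindDomain IsDedekindDomain.HeightOneSpectrum WithZero

namespace Literature.NumberTheory.EllipticCurves

namespace Mod8Prime

variable {K : Type*} [Field K] [NumberField K] (ρ : 𝓞 K →+* ZMod 8)

/-! ### Odd residues modulo `8` -/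

/-- Reduction `ℤ/8 → ℤ/2`. [folklore] -/
def c82 : ZMod 8 →+* ZMod 2 := ZMod.castHom (show 2 ∣ 8 by norm_num) (ZMod 2)

/-- Odd residues modulo `8`. [folklore] -/
def IsOdd (r : ZMod 8) : Prop := r = 1 ∨ r = 3 ∨ r = 5 ∨ r = 7

/-- `IsOdd` is decidable. [folklore] -/
instance : DecidablePred IsOdd := fun r => by unfold IsOdd; infer_instance

/-- `r` is odd iff `r mod 2 ≠ 0`. [folklore] -/
theorem isOdd_iff_c82_ne_zero : ∀ r : ZMod 8, IsOdd r ↔ c82 r ≠ 0 := by decide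

/-- Odd squares are `1 (mod 8)`. [folklore] -/
theorem mul_self_of_isOdd : ∀ r : ZMod 8, IsOdd r → r * r = 1 := by decide

/-- A product is odd iff both factors are. [folklore] -/
theorem isOdd_mul_iff : ∀ r r' : ZMod 8, IsOdd (r * r') ↔ IsOdd r ∧ IsOdd r' := by decide

/-- An odd residue is not twice a residue. [folklore] -/
theorem isOdd_ne_two_mul : ∀ r t : ZMod 8, IsOdd r → r ≠ 2 * t := by decide

/-- `2^k = 0` in `ℤ/8` for `k ≥ 3`. [folklore] -/
theorem two_pow_eq_zero {k : ℕ} (hk : 3 ≤ k) : (2 : ZMod 8) ^ k = 0 := by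
  obtain ⟨m, rfl⟩ := Nat.exists_eq_add_of_le hk
  rw [pow_add, show (2 : ZMod 8) ^ 3 = 0 by decide, zero_mul]

/-- `2^k = 2 · 2^(k-1)` for `k ≥ 1`. [folklore] -/
theorem two_pow_eq_two_mul {k : ℕ} (hk : 1 ≤ k) : (2 : ZMod 8) ^ k = 2 * 2 ^ (k - 1) := by
  obtain ⟨m, rfl⟩ := Nat.exists_eq_add_of_le hk
  rw [pow_add, pow_one, Nat.add_sub_cancel_left]

/-! ### The prime `𝔭 = ker(ρ mod 2)` -/

/-- **The ideal `𝔭_ρ = ker(ρ mod 2)`.** [folklore] -/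
def ideal : Ideal (𝓞 K) := RingHom.ker (c82.comp ρ)

omit [NumberField K] in
/-- `z ∈ 𝔭_ρ ↔ ρ(z)` is even. [folklore] -/
theorem mem_ideal_iff {z : 𝓞 K} : z ∈ ideal ρ ↔ ¬ IsOdd (ρ z) := by
  rw [ideal, RingHom.mem_ker, RingHom.comp_apply, isOdd_iff_c82_ne_zero, not_not]

omit [NumberField K] in
/-- `z ∉ 𝔭_ρ ↔ ρ(z)` is odd. [folklore] -/
theorem not_mem_ideal_iff {z : 𝓞 K} : z ∉ ideal ρ ↔ IsOdd (ρ z) := by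
  rw [mem_ideal_iff, not_not]

omit [NumberField K] in
/-- `𝔭_ρ` is maximal (`𝓞 K/𝔭_ρ = 𝔽₂`). [folklore] -/
theorem isMaximal_ideal : (ideal ρ).IsMaximal := by
  haveI : Fact (Nat.Prime 2) := ⟨Nat.prime_two⟩
  exact RingHom.ker_isMaximal_of_surjective _ (ZMod.ringHom_surjective (c82.comp ρ))

omit [NumberField K] in
/-- `2 ∈ 𝔭_ρ`. [folklore] -/
theorem two_mem : (2 : 𝓞 K) ∈ ideal ρ := by
  rw [mem_ideal_iff, map_ofNat]; decide

/-- `𝔭_ρ ≠ 0`. [folklore] -/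
theorem ideal_ne_bot : ideal ρ ≠ ⊥ := fun h => by
  have h2 := two_mem ρ
  rw [h, Ideal.mem_bot] at h2
  exact two_ne_zero h2

/-- **The prime `𝔭_ρ` as a point of the height-one spectrum.** [folklore] -/
def prime : HeightOneSpectrum (𝓞 K) := ⟨ideal ρ, (isMaximal_ideal ρ).isPrime, ideal_ne_bot ρ⟩

/-- The underlying ideal of `prime ρ`. [folklore] -/
@[simp] theorem prime_asIdeal : (prime ρ).asIdeal = ideal ρ := rfl

/-- A product of two even residues is `0` or `4` modulo `8`. [folklore] -/
theorem even_mul_even : ∀ r r' : ZMod 8, ¬ IsOdd r → ¬ IsOdd r' → r * r' = 0 ∨ r * r' = 4 := by decide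

omit [NumberField K] in
/-- `𝔭_ρ² ⊆ ρ⁻¹(4ℤ/8)`: products of two even residues are divisible by `4`. [folklore] -/
theorem sq_le_comap : (ideal ρ) ^ 2 ≤ Ideal.comap ρ (Ideal.span {(4 : ZMod 8)}) := by
  rw [pow_two, Ideal.mul_le]
  intro a ha b hb
  rw [mem_ideal_iff] at ha hb
  rw [Ideal.mem_comap, map_mul]
  rcases even_mul_even _ _ ha hb with h0 | h4
  · rw [h0]; exact Submodule.zero_mem _
  · rw [h4]; exact Ideal.mem_span_singleton_self 4

omit [NumberField K] in
/-- `2 ∉ 𝔭_ρ²` (`ρ(2) = 2` is not divisible by `4` in `ℤ/8`). [folklore] -/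
theorem two_not_mem_sq : (2 : 𝓞 K) ∉ (ideal ρ) ^ 2 := fun h => by
  have h4 := sq_le_comap ρ h
  rw [Ideal.mem_comap, map_ofNat, Ideal.mem_span_singleton'] at h4
  obtain ⟨t, ht⟩ := h4
  revert ht
  revert t
  decide

/-- **`ord_𝔭(2) = 1`: `2` is a uniformiser at `𝔭_ρ`** (unramified prime above `2`). [folklore] -/
theorem intValuation_two : (prime ρ).intValuation (2 : 𝓞 K) = exp (-1 : ℤ) := by
  classical
  have h1 : (prime ρ).intValuation (2 : 𝓞 K) ≤ exp (-((1 : ℕ) : ℤ)) := by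
    rw [intValuation_le_pow_iff_mem, prime_asIdeal, pow_one]; exact two_mem ρ
  have h2 : ¬ (prime ρ).intValuation (2 : 𝓞 K) ≤ exp (-((2 : ℕ) : ℤ)) := fun h => by
    rw [intValuation_le_pow_iff_mem, prime_asIdeal] at h
    exact two_not_mem_sq ρ h
  have hv0 : (prime ρ).intValuation (2 : 𝓞 K) ≠ 0 :=
    (prime ρ).intValuation_ne_zero (2 : 𝓞 K) two_ne_zero
  rw [← exp_log hv0] at h1 h2 ⊢
  rw [exp_le_exp] at h1 h2
  rw [exp_inj]
  omega

/-- `ord_𝔭(2) = 1` on `K`. [folklore] -/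
theorem valuation_two : (prime ρ).valuation K (2 : K) = exp (-1 : ℤ) := by
  rw [← map_ofNat (algebraMap (𝓞 K) K) 2, valuation_of_algebraMap, intValuation_two]

/-- `(2 : K) ≠ 0`. [folklore] -/
theorem two_ne_zero_K : (2 : K) ≠ 0 := two_ne_zero

/-- `ord_𝔭(2ⁿ) = n`. [folklore] -/
theorem valuation_two_zpow (n : ℤ) : (prime ρ).valuation K ((2 : K) ^ n) = exp (-n) := by
  rw [map_zpow₀, valuation_two, ← exp_zsmul, smul_eq_mul, mul_neg, mul_one]

/-- Elements outside `𝔭_ρ` have valuation `1`. [folklore] -/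
theorem valuation_eq_one_of_not_mem {s : 𝓞 K} (hs : s ∉ ideal ρ) :
    (prime ρ).valuation K (algebraMap (𝓞 K) K s) = 1 := by
  rw [valuation_of_algebraMap, intValuation_eq_one_iff]; exact hs

omit [NumberField K] in
/-- Elements outside `𝔭_ρ` are non-zero in `K`. [folklore] -/
theorem coe_ne_zero_of_not_mem {s : 𝓞 K} (hs : s ∉ ideal ρ) : (algebraMap (𝓞 K) K s) ≠ 0 := by
  intro h0
  rw [map_eq_zero_iff _ (FaithfulSMul.algebraMap_injective (𝓞 K) K)] at h0
  exact hs (h0 ▸ Submodule.zero_mem _)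

/-! ### `𝔭`-integral elements of `K` and their residues modulo `8` -/

/-- **`z ∈ K` is `𝔭`-integral with residue `r (mod 8)`**: `z s = u` with `u, s ∈ 𝓞 K`, `s ∉ 𝔭`,
`ρ(u s) = r` (i.e. `r = ρ(u)/ρ(s)`, as `ρ(s)² = 1`). [folklore] -/
def LocI (z : K) (r : ZMod 8) : Prop :=
  ∃ u s : 𝓞 K, s ∉ ideal ρ ∧ ρ (u * s) = r ∧ z * algebraMap (𝓞 K) K s = algebraMap (𝓞 K) K u

/-- **`z ∈ K` is a `𝔭`-unit with residue `r (mod 8)`.** [folklore] -/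
def LocU (z : K) (r : ZMod 8) : Prop :=
  ∃ u s : 𝓞 K, u ∉ ideal ρ ∧ s ∉ ideal ρ ∧ ρ (u * s) = r ∧
    z * algebraMap (𝓞 K) K s = algebraMap (𝓞 K) K u

/-- **`z = 2ⁿ · (𝔭-unit of residue r)`**: the class `(n, r)` of `z` in `ℚ₂ˣ ⊃ Kˣ`. [folklore] -/
def LocQ (z : K) (n : ℤ) (r : ZMod 8) : Prop := LocU ρ ((2 : K) ^ (-n) * z) r

variable {ρ}

omit [NumberField K] in
/-- **Residues are unique.** [folklore] -/
theorem LocI.unique {z : K} {r r' : ZMod 8} (h : LocI ρ z r) (h' : LocI ρ z r') : r = r' := by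
  obtain ⟨u, s, hs, hr, hz⟩ := h
  obtain ⟨u', s', hs', hr', hz'⟩ := h'
  have e : u * s' = u' * s := by
    apply FaithfulSMul.algebraMap_injective (𝓞 K) K
    rw [map_mul, map_mul, ← hz, ← hz']
    ring
  have he := congrArg ρ e
  rw [map_mul, map_mul] at he
  rw [map_mul] at hr hr'
  have h1 := mul_self_of_isOdd _ ((not_mem_ideal_iff ρ).mp hs)
  have h2 := mul_self_of_isOdd _ ((not_mem_ideal_iff ρ).mp hs')
  calc r = ρ u * ρ s * (ρ s' * ρ s') := by rw [h2, mul_one, hr]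
    _ = ρ u * ρ s' * ρ s * ρ s' := by ring
    _ = ρ u' * ρ s * ρ s * ρ s' := by rw [he]
    _ = ρ u' * ρ s' * (ρ s * ρ s) := by ring
    _ = r' := by rw [h1, mul_one, hr']

omit [NumberField K] in
/-- An element of `𝓞 K` is `𝔭`-integral with residue `ρ`. [folklore] -/
theorem locI_coe (u : 𝓞 K) : LocI ρ (algebraMap (𝓞 K) K u) (ρ u) :=
  ⟨u, 1, fun h => (isMaximal_ideal ρ).ne_top ((ideal ρ).eq_top_of_isUnit_mem h isUnit_one),
    by rw [mul_one], by rw [map_one, mul_one]⟩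

omit [NumberField K] in
/-- An integer `n` is `𝔭`-integral with residue `n`. [folklore] -/
theorem locI_intCast (n : ℤ) : LocI ρ (n : K) (n : ZMod 8) := by
  have h := locI_coe (ρ := ρ) (n : 𝓞 K)
  rwa [map_intCast, map_intCast] at h

omit [NumberField K] in
/-- A natural number `n` is `𝔭`-integral with residue `n`. [folklore] -/
theorem locI_natCast (n : ℕ) : LocI ρ (n : K) (n : ZMod 8) := by
  have h := locI_intCast (ρ := ρ) (n : ℤ)
  rwa [Int.cast_natCast, Int.cast_natCast] at h

omit [NumberField K] in
/-- `2^k` is `𝔭`-integral with residue `2^k`. [folklore] -/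
theorem locI_two_pow (k : ℕ) : LocI ρ ((2 : K) ^ k) ((2 : ZMod 8) ^ k) := by
  have h := locI_natCast (ρ := ρ) (2 ^ k)
  rwa [Nat.cast_pow, Nat.cast_pow, Nat.cast_ofNat, Nat.cast_ofNat] at h

omit [NumberField K] in
/-- Sums of `𝔭`-integral elements. [folklore] -/
theorem LocI.add {z z' : K} {r r' : ZMod 8} (h : LocI ρ z r) (h' : LocI ρ z' r') :
    LocI ρ (z + z') (r + r') := by
  obtain ⟨u, s, hs, hr, hz⟩ := h
  obtain ⟨u', s', hs', hr', hz'⟩ := h'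
  have h1 := mul_self_of_isOdd _ ((not_mem_ideal_iff ρ).mp hs)
  have h2 := mul_self_of_isOdd _ ((not_mem_ideal_iff ρ).mp hs')
  refine ⟨u * s' + u' * s, s * s', fun hm => ?_, ?_, ?_⟩
  · rcases (isMaximal_ideal ρ).isPrime.mem_or_mem hm with h0 | h0
    exacts [hs h0, hs' h0]
  · rw [map_mul] at hr hr'
    rw [← hr, ← hr']
    simp only [map_add, map_mul]
    linear_combination (ρ u * ρ s) * h2 + (ρ u' * ρ s') * h1
  · rw [map_mul, map_add, map_mul, map_mul, ← hz, ← hz']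
    ring

omit [NumberField K] in
/-- Negatives of `𝔭`-integral elements. [folklore] -/
theorem LocI.neg {z : K} {r : ZMod 8} (h : LocI ρ z r) : LocI ρ (-z) (-r) := by
  obtain ⟨u, s, hs, hr, hz⟩ := h
  exact ⟨-u, s, hs, by rw [neg_mul, map_neg, hr], by rw [map_neg, ← hz]; ring⟩

omit [NumberField K] in
/-- Differences of `𝔭`-integral elements. [folklore] -/
theorem LocI.sub {z z' : K} {r r' : ZMod 8} (h : LocI ρ z r) (h' : LocI ρ z' r') :
    LocI ρ (z - z') (r - r') := by
  have := h.add h'.neg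
  rwa [← sub_eq_add_neg, ← sub_eq_add_neg] at this

omit [NumberField K] in
/-- Products of `𝔭`-integral elements. [folklore] -/
theorem LocI.mul {z z' : K} {r r' : ZMod 8} (h : LocI ρ z r) (h' : LocI ρ z' r') :
    LocI ρ (z * z') (r * r') := by
  obtain ⟨u, s, hs, hr, hz⟩ := h
  obtain ⟨u', s', hs', hr', hz'⟩ := h'
  refine ⟨u * u', s * s', fun hm => ?_, ?_, ?_⟩
  · rcases (isMaximal_ideal ρ).isPrime.mem_or_mem hm with h0 | h0
    exacts [hs h0, hs' h0]
  · rw [← hr, ← hr']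
    simp only [map_mul]
    ring
  · rw [map_mul, map_mul, ← hz, ← hz']
    ring

omit [NumberField K] in
/-- A `𝔭`-unit is `𝔭`-integral. [folklore] -/
theorem LocU.locI {z : K} {r : ZMod 8} (h : LocU ρ z r) : LocI ρ z r := by
  obtain ⟨u, s, -, hs, hr, hz⟩ := h
  exact ⟨u, s, hs, hr, hz⟩

omit [NumberField K] in
/-- The residue of a `𝔭`-unit is odd. [folklore] -/
theorem LocU.isOdd {z : K} {r : ZMod 8} (h : LocU ρ z r) : IsOdd r := by
  obtain ⟨u, s, hu, hs, hr, -⟩ := h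
  rw [← hr, map_mul, isOdd_mul_iff]
  exact ⟨(not_mem_ideal_iff ρ).mp hu, (not_mem_ideal_iff ρ).mp hs⟩

omit [NumberField K] in
/-- `r² = 1` for the residue of a `𝔭`-unit. [folklore] -/
theorem LocU.mul_self {z : K} {r : ZMod 8} (h : LocU ρ z r) : r * r = 1 := mul_self_of_isOdd _ h.isOdd

omit [NumberField K] in
/-- **A `𝔭`-integral element with odd residue is a `𝔭`-unit.** [folklore] -/
theorem LocI.locU {z : K} {r : ZMod 8} (h : LocI ρ z r) (hr : IsOdd r) : LocU ρ z r := by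
  obtain ⟨u, s, hs, hr', hz⟩ := h
  refine ⟨u, s, ?_, hs, hr', hz⟩
  rw [not_mem_ideal_iff]
  rw [← hr', map_mul, isOdd_mul_iff] at hr
  exact hr.1

omit [NumberField K] in
/-- Residues of `𝔭`-units are unique. [folklore] -/
theorem LocU.unique {z : K} {r r' : ZMod 8} (h : LocU ρ z r) (h' : LocU ρ z r') : r = r' :=
  h.locI.unique h'.locI

omit [NumberField K] in
/-- A `𝔭`-unit is non-zero. [folklore] -/
theorem LocU.ne_zero {z : K} {r : ZMod 8} (h : LocU ρ z r) : z ≠ 0 := by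
  obtain ⟨u, s, hu, -, -, hz⟩ := h
  intro h0
  rw [h0, zero_mul] at hz
  exact coe_ne_zero_of_not_mem ρ hu hz.symm

omit [NumberField K] in
/-- **The quotient `u/s` of two elements outside `𝔭` is a `𝔭`-unit of residue `ρ(u s)`.** [folklore] -/
theorem locU_div {u s : 𝓞 K} (hu : u ∉ ideal ρ) (hs : s ∉ ideal ρ) :
    LocU ρ (algebraMap (𝓞 K) K u / algebraMap (𝓞 K) K s) (ρ (u * s)) :=
  ⟨u, s, hu, hs, rfl, div_mul_cancel₀ _ (coe_ne_zero_of_not_mem ρ hs)⟩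

omit [NumberField K] in
/-- An element outside `𝔭` is a `𝔭`-unit of residue `ρ`. [folklore] -/
theorem locU_coe {u : 𝓞 K} (hu : u ∉ ideal ρ) : LocU ρ (algebraMap (𝓞 K) K u) (ρ u) :=
  (locI_coe u).locU ((not_mem_ideal_iff ρ).mp hu)

omit [NumberField K] in
/-- `1` is a `𝔭`-unit of residue `1`. [folklore] -/
theorem locU_one : LocU ρ (1 : K) 1 := by
  have h := locI_intCast (ρ := ρ) 1
  rw [Int.cast_one, Int.cast_one] at h
  exact h.locU (by decide)

omit [NumberField K] in
/-- Products of `𝔭`-units. [folklore] -/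
theorem LocU.mul {z z' : K} {r r' : ZMod 8} (h : LocU ρ z r) (h' : LocU ρ z' r') :
    LocU ρ (z * z') (r * r') :=
  (h.locI.mul h'.locI).locU ((isOdd_mul_iff _ _).mpr ⟨h.isOdd, h'.isOdd⟩)

omit [NumberField K] in
/-- Inverses of `𝔭`-units. [folklore] -/
theorem LocU.inv {z : K} {r : ZMod 8} (h : LocU ρ z r) : LocU ρ z⁻¹ r := by
  have hz := h.ne_zero
  obtain ⟨u, s, hu, hs, hr, hzs⟩ := h
  refine ⟨s, u, hs, hu, by rw [mul_comm, hr], ?_⟩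
  rw [← hzs, ← mul_assoc, inv_mul_cancel₀ hz, one_mul]

omit [NumberField K] in
/-- Squares of `𝔭`-units have residue `1`. [folklore] -/
theorem LocU.sq {z : K} {r : ZMod 8} (h : LocU ρ z r) : LocU ρ (z ^ 2) 1 := by
  have h2 := h.mul h
  rwa [← pow_two, h.mul_self] at h2

/-- **Valuation of a `𝔭`-unit is `1`** (`ord_𝔭 = 0`). [folklore] -/
theorem LocU.valuation_eq_one {z : K} {r : ZMod 8} (h : LocU ρ z r) : (prime ρ).valuation K z = 1 := by
  obtain ⟨u, s, hu, hs, -, hz⟩ := h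
  have hv := congrArg ((prime ρ).valuation K) hz
  rwa [map_mul, valuation_eq_one_of_not_mem ρ hs, valuation_eq_one_of_not_mem ρ hu, mul_one] at hv

/-- **Every element of valuation `1` is a `𝔭`-unit** (with some residue). [folklore] -/
theorem exists_locU_of_valuation_eq_one {z : K} (hz : (prime ρ).valuation K z = 1) : ∃ r, LocU ρ z r := by
  obtain ⟨u, s, hus⟩ := exists_primeCompl_mul_eq_of_integer (prime ρ) z hz.le
  have hs : (s : 𝓞 K) ∉ ideal ρ := s.2
  have hu : u ∉ ideal ρ := by
    intro hmem
    have hv := congrArg ((prime ρ).valuation K) hus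
    rw [map_mul, hz, one_mul, valuation_eq_one_of_not_mem ρ hs, eq_comm, valuation_of_algebraMap,
      intValuation_eq_one_iff] at hv
    exact hv hmem
  exact ⟨ρ (u * s), u, (s : 𝓞 K), hu, hs, rfl, hus⟩

/-- **The exponent and the residue of `2ᵐ U` (`U` a `𝔭`-unit) are unique**: one direction. [folklore] -/
theorem LocU.exp_unique_le {U U' : K} {r r' : ZMod 8} (h : LocU ρ U r) (h' : LocU ρ U' r') {m m' : ℤ}
    (hle : m ≤ m') (e : (2 : K) ^ m * U = (2 : K) ^ m' * U') : m = m' ∧ r = r' := by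
  obtain ⟨d, hd⟩ := Int.le.dest hle
  have hU : U = (2 : K) ^ d * U' := by
    have h2 : (2 : K) ^ m ≠ 0 := zpow_ne_zero m two_ne_zero_K
    apply mul_left_cancel₀ h2
    rw [e, ← hd, zpow_add₀ two_ne_zero_K, zpow_natCast, mul_assoc]
  rcases Nat.eq_zero_or_pos d with hd0 | hdpos
  · subst hd0
    rw [pow_zero, one_mul] at hU
    subst hU
    exact ⟨by omega, h.unique h'⟩
  · exfalso
    have hI : LocI ρ U (2 ^ d * r') := by rw [hU]; exact (locI_two_pow d).mul h'.locI
    have hr : r = 2 ^ d * r' := h.locI.unique hI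
    rw [two_pow_eq_two_mul hdpos, mul_assoc] at hr
    exact isOdd_ne_two_mul _ _ h.isOdd hr

/-- **The exponent and the residue of `2ᵐ U` (`U` a `𝔭`-unit) are unique.** [folklore] -/
theorem LocU.exp_unique {U U' : K} {r r' : ZMod 8} (h : LocU ρ U r) (h' : LocU ρ U' r') {m m' : ℤ}
    (e : (2 : K) ^ m * U = (2 : K) ^ m' * U') : m = m' ∧ r = r' := by
  rcases le_total m m' with hle | hle
  · exact h.exp_unique_le h' hle e
  · obtain ⟨h1, h2⟩ := h'.exp_unique_le h hle e.symm
    exact ⟨h1.symm, h2.symm⟩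

/-! ### The class `(n, r)` of a non-zero element -/

omit [NumberField K] in
/-- `LocQ ρ z 0 r ↔ LocU ρ z r`. [folklore] -/
theorem locQ_zero_iff {z : K} {r : ZMod 8} : LocQ ρ z 0 r ↔ LocU ρ z r := by
  rw [LocQ, neg_zero, zpow_zero, one_mul]

/-- `z = 2ⁿ · (2⁻ⁿ z)`. [folklore] -/
theorem eq_two_zpow_mul (z : K) (n : ℤ) : z = (2 : K) ^ n * ((2 : K) ^ (-n) * z) := by
  rw [← mul_assoc, ← zpow_add₀ two_ne_zero_K, add_neg_cancel, zpow_zero, one_mul]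

/-- **Every `z ≠ 0` has a class `(n, r)`.** [folklore] -/
theorem exists_locQ {z : K} (hz : z ≠ 0) : ∃ (n : ℤ) (r : ZMod 8), LocQ ρ z n r := by
  set n : ℤ := -log ((prime ρ).valuation K z) with hn
  have hv0 : (prime ρ).valuation K z ≠ 0 := (Valuation.ne_zero_iff _).mpr hz
  have hv : (prime ρ).valuation K ((2 : K) ^ (-n) * z) = 1 := by
    rw [map_mul, valuation_two_zpow, neg_neg, hn, exp_neg, exp_log hv0, inv_mul_cancel₀ hv0]
  obtain ⟨r, hr⟩ := exists_locU_of_valuation_eq_one hv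
  exact ⟨n, r, hr⟩

/-- **The class `(n, r)` is unique.** [folklore] -/
theorem LocQ.unique {z : K} {n n' : ℤ} {r r' : ZMod 8} (h : LocQ ρ z n r) (h' : LocQ ρ z n' r') :
    n = n' ∧ r = r' :=
  LocU.exp_unique h h' (by rw [← eq_two_zpow_mul, ← eq_two_zpow_mul])

omit [NumberField K] in
/-- The residue of a class is odd. [folklore] -/
theorem LocQ.isOdd {z : K} {n : ℤ} {r : ZMod 8} (h : LocQ ρ z n r) : IsOdd r := LocU.isOdd h

omit [NumberField K] in
/-- A classed element is non-zero. [folklore] -/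
theorem LocQ.ne_zero {z : K} {n : ℤ} {r : ZMod 8} (h : LocQ ρ z n r) : z ≠ 0 := by
  intro h0
  have := LocU.ne_zero h
  rw [h0, mul_zero] at this
  exact this rfl

/-- **Classes are multiplicative.** [folklore] -/
theorem LocQ.mul {z z' : K} {n n' : ℤ} {r r' : ZMod 8} (h : LocQ ρ z n r) (h' : LocQ ρ z' n' r') :
    LocQ ρ (z * z') (n + n') (r * r') := by
  have hm := LocU.mul h h'
  rw [LocQ]
  convert hm using 1
  rw [neg_add, zpow_add₀ two_ne_zero_K]
  ring

omit [NumberField K] in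
/-- Classes of inverses. [folklore] -/
theorem LocQ.inv {z : K} {n : ℤ} {r : ZMod 8} (h : LocQ ρ z n r) : LocQ ρ z⁻¹ (-n) r := by
  have hi := LocU.inv h
  rw [LocQ]
  convert hi using 2
  rw [mul_inv, ← zpow_neg]

/-- Classes of squares: `(2n, 1)`. [folklore] -/
theorem LocQ.sq {z : K} {n : ℤ} {r : ZMod 8} (h : LocQ ρ z n r) : LocQ ρ (z ^ 2) (2 * n) 1 := by
  have h2 := h.mul h
  rw [LocU.mul_self h, ← pow_two, ← two_mul] at h2
  exact h2

omit [NumberField K] in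
/-- The class of a `𝔭`-unit. [folklore] -/
theorem LocU.locQ {z : K} {r : ZMod 8} (h : LocU ρ z r) : LocQ ρ z 0 r := locQ_zero_iff.mpr h

/-- The class of `2` is `(1, 1)`. [folklore] -/
theorem locQ_two : LocQ ρ (2 : K) 1 1 := by
  rw [LocQ, zpow_neg, zpow_one, inv_mul_cancel₀ two_ne_zero_K]
  exact locU_one

/-- The class of `2^k · u/s` (`u, s ∉ 𝔭`) is `(k, ρ(u s))`: the form in which explicit classes are
certified. [folklore] -/
theorem locQ_of_mul_eq {z : K} {k : ℕ} {u s : 𝓞 K} (hu : u ∉ ideal ρ) (hs : s ∉ ideal ρ)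
    (e : z * algebraMap (𝓞 K) K s = (2 : K) ^ k * algebraMap (𝓞 K) K u) : LocQ ρ z k (ρ (u * s)) := by
  refine ⟨u, s, hu, hs, rfl, ?_⟩
  rw [mul_assoc, e, ← mul_assoc, ← zpow_natCast, ← zpow_add₀ two_ne_zero_K, neg_add_cancel, zpow_zero,
    one_mul]

/-- **`ord_𝔭(z) = n` for a class `(n, r)`.** [folklore] -/
theorem LocQ.valuation_eq {z : K} {n : ℤ} {r : ZMod 8} (h : LocQ ρ z n r) :
    (prime ρ).valuation K z = exp (-n) := by
  have hv := LocU.valuation_eq_one h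
  rw [map_mul, valuation_two_zpow, neg_neg] at hv
  calc (prime ρ).valuation K z = exp (-n) * (exp n * (prime ρ).valuation K z) := by
        rw [← mul_assoc, ← exp_add, neg_add_cancel, exp_zero, one_mul]
    _ = exp (-n) := by rw [hv, mul_one]

/-- `log ord`: `log v_𝔭(z) = -n`. [folklore] -/
theorem LocQ.log_valuation_eq {z : K} {n : ℤ} {r : ZMod 8} (h : LocQ ρ z n r) :
    log ((prime ρ).valuation K z) = -n := by
  rw [h.valuation_eq, log_exp]

/-- Unfolding a class: `z = 2ⁿ X` with `X` a `𝔭`-unit of residue `r`. [folklore] -/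
theorem LocQ.exists_eq {z : K} {n : ℤ} {r : ZMod 8} (h : LocQ ρ z n r) :
    ∃ X : K, LocU ρ X r ∧ z = (2 : K) ^ n * X :=
  ⟨_, h, eq_two_zpow_mul z n⟩

/-! ### The local image of the `2`-descent map of `480a1` at `𝔭` -/

/-- **The local image `W ⊂ (ℚ₂ˣ/ℚ₂ˣ²)²` of `E(ℚ₂) → (x, x + 2)` for `E = 480a1`**, on classes
`(a mod 2, rα mod 8; b mod 2, rβ mod 8)`:
`{(0,1;0,1), (0,3;0,5), (0,5;0,5), (0,7;0,1), (1,1;1,5), (1,3;1,1), (1,5;1,1), (1,7;1,5)}`. [folklore] -/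
def W480 (a b : ℤ) (ra rb : ZMod 8) : Prop :=
  (a % 2 = 0 ∧ b % 2 = 0 ∧ ((ra = 1 ∧ rb = 1) ∨ (ra = 3 ∧ rb = 5) ∨ (ra = 5 ∧ rb = 5) ∨ (ra = 7 ∧ rb = 1))) ∨
  (a % 2 = 1 ∧ b % 2 = 1 ∧ ((ra = 1 ∧ rb = 5) ∨ (ra = 3 ∧ rb = 1) ∨ (ra = 5 ∧ rb = 1) ∨ (ra = 7 ∧ rb = 5)))

/-- `W480` is decidable. [folklore] -/
instance (a b : ℤ) (ra rb : ZMod 8) : Decidable (W480 a b ra rb) := by unfold W480; infer_instance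

/-- The residue arithmetic of case `ord(x) < 0`, `ord(x) = -2`. [folklore] -/
theorem W_case_neg_one : ∀ ra rb : ZMod 8, IsOdd ra → rb = ra + 2 ^ 3 → ra * rb = ra - 3 * 4 ^ 1 →
    (ra = 1 ∧ rb = 1) ∨ (ra = 3 ∧ rb = 5) ∨ (ra = 5 ∧ rb = 5) ∨ (ra = 7 ∧ rb = 1) := by decide

/-- The residue arithmetic of case `ord(x) < 0`, `ord(x) ≤ -4`. [folklore] -/
theorem W_case_neg_two : ∀ ra rb : ZMod 8, IsOdd ra → rb = ra + 0 → ra * rb = ra - 3 * 0 →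
    (ra = 1 ∧ rb = 1) ∨ (ra = 3 ∧ rb = 5) ∨ (ra = 5 ∧ rb = 5) ∨ (ra = 7 ∧ rb = 1) := by decide

/-- The residue arithmetic of case `ord(x) = 0`, `ord(x - 3) = 2`. [folklore] -/
theorem W_case_zero_two : ∀ ra rb : ZMod 8, IsOdd ra → IsOdd rb → rb = ra + 2 → ra - 3 = 2 ^ 2 * (ra * rb) →
    (ra = 1 ∧ rb = 1) ∨ (ra = 3 ∧ rb = 5) ∨ (ra = 5 ∧ rb = 5) ∨ (ra = 7 ∧ rb = 1) := by decide

/-- The residue arithmetic of case `ord(x) = 0`, `ord(x - 3) ≥ 3`. [folklore] -/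
theorem W_case_zero_three : ∀ ra rb : ZMod 8, IsOdd ra → rb = ra + 2 → ra - 3 = 0 * (ra * rb) →
    (ra = 1 ∧ rb = 1) ∨ (ra = 3 ∧ rb = 5) ∨ (ra = 5 ∧ rb = 5) ∨ (ra = 7 ∧ rb = 1) := by decide

/-- The residue arithmetic of case `ord(x) = 3`. [folklore] -/
theorem W_case_three : ∀ ra rb : ZMod 8, IsOdd ra → rb = 2 ^ 2 * ra + 1 → ra * rb = 2 ^ 3 * ra - 3 →
    (ra = 1 ∧ rb = 5) ∨ (ra = 3 ∧ rb = 1) ∨ (ra = 5 ∧ rb = 1) ∨ (ra = 7 ∧ rb = 5) := by decide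

/-- The residue arithmetic of case `ord(x) ≥ 4`. [folklore] -/
theorem W_case_four : ∀ ra rb : ZMod 8, IsOdd ra → rb = 0 * ra + 1 → ra * rb = 0 * ra - 3 →
    (ra = 1 ∧ rb = 5) ∨ (ra = 3 ∧ rb = 1) ∨ (ra = 5 ∧ rb = 1) ∨ (ra = 7 ∧ rb = 5) := by decide

/-- The residue arithmetic of case `ord(x) = 1`, `ord(x + 2) = 3`. [folklore] -/
theorem W_case_one_two : ∀ ra rb : ZMod 8, IsOdd ra → IsOdd rb → ra * rb = 2 * ra - 3 → ra + 1 = 2 ^ 2 * rb →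
    (ra = 1 ∧ rb = 5) ∨ (ra = 3 ∧ rb = 1) ∨ (ra = 5 ∧ rb = 1) ∨ (ra = 7 ∧ rb = 5) := by decide

/-- The residue arithmetic of case `ord(x) = 1`, `ord(x + 2) ≥ 4`. [folklore] -/
theorem W_case_one_three : ∀ ra rb : ZMod 8, IsOdd ra → IsOdd rb → ra * rb = 2 * ra - 3 → ra + 1 = 0 * rb →
    (ra = 1 ∧ rb = 5) ∨ (ra = 3 ∧ rb = 1) ∨ (ra = 5 ∧ rb = 1) ∨ (ra = 7 ∧ rb = 5) := by decide

/-- No odd `t (ra - 3)`-type coincidence: `ra rb ≠ t (ra - 3)` for odd `ra, rb`. [folklore] -/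
theorem odd_mul_ne_mul_sub_three : ∀ ra rb t : ZMod 8, IsOdd ra → IsOdd rb → ra * rb ≠ t * (ra - 3) := by
  decide

/-- `rb ≠ t (ra + 1)` for odd `ra, rb`. [folklore] -/
theorem odd_ne_mul_add_one : ∀ ra rb t : ZMod 8, IsOdd ra → IsOdd rb → rb ≠ t * (ra + 1) := by decide

/-- `ra - 3 · 2 t` is odd for odd `ra`. [folklore] -/
theorem isOdd_sub_three_mul_two_mul : ∀ ra t : ZMod 8, IsOdd ra → IsOdd (ra - 3 * (2 * t)) := by decide

/-- `ra + 2 t` is odd for odd `ra`. [folklore] -/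
theorem isOdd_add_two_mul : ∀ ra t : ZMod 8, IsOdd ra → IsOdd (ra + 2 * t) := by decide

/-- `2 t ra - 3` is odd. [folklore] -/
theorem isOdd_two_mul_sub_three : ∀ ra t : ZMod 8, IsOdd (2 * t * ra - 3) := by decide

/-- `2 t ra + 1` is odd. [folklore] -/
theorem isOdd_two_mul_add_one : ∀ ra t : ZMod 8, IsOdd (2 * t * ra + 1) := by decide

section LocalImage

variable {x y α β A B : K} {a b : ℤ} {ra rb : ZMod 8}

omit [NumberField K] in
/-- `x, x + 2, x - 3 ≠ 0` on `y² = x(x+2)(x-3)`, `y ≠ 0`. [folklore] -/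
theorem x_ne_zero_of_eq (hE : y ^ 2 = x * (x + 2) * (x - 3)) (hy : y ≠ 0) :
    x ≠ 0 ∧ x + 2 ≠ 0 ∧ x - 3 ≠ 0 := by
  have h : x * (x + 2) * (x - 3) ≠ 0 := by rw [← hE]; exact pow_ne_zero 2 hy
  exact ⟨fun h0 => h (by rw [h0]; ring), fun h0 => h (by rw [h0]; ring), fun h0 => h (by rw [h0]; ring)⟩

/-- **The three classes of `x, x + 2, x - 3`.** From `x = α A²`, `x + 2 = β B²` and the curve
equation, `x - 3 = α β C²` with `C = y/(α β A B)`, so the classes are `(a + 2j_A, rα)`,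
`(b + 2j_B, rβ)`, `(a + b + 2j_C, rα rβ)`. [folklore] -/
theorem exists_classes (hE : y ^ 2 = x * (x + 2) * (x - 3)) (hy : y ≠ 0) (hx : x = α * A ^ 2)
    (hx2 : x + 2 = β * B ^ 2) (hα : LocQ ρ α a ra) (hβ : LocQ ρ β b rb) :
    ∃ jA jB jC : ℤ, LocQ ρ x (a + 2 * jA) ra ∧ LocQ ρ (x + 2) (b + 2 * jB) rb ∧
      LocQ ρ (x - 3) (a + b + 2 * jC) (ra * rb) := by
  obtain ⟨hx0, hx20, hx30⟩ := x_ne_zero_of_eq hE hy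
  have hA0 : A ≠ 0 := by rintro rfl; apply hx0; rw [hx]; ring
  have hB0 : B ≠ 0 := by rintro rfl; apply hx20; rw [hx2]; ring
  have hα0 : α ≠ 0 := hα.ne_zero
  have hβ0 : β ≠ 0 := hβ.ne_zero
  obtain ⟨jA, rA, hA⟩ := exists_locQ (ρ := ρ) hA0
  obtain ⟨jB, rB, hB⟩ := exists_locQ (ρ := ρ) hB0
  have hden : α * β * A * B ≠ 0 := mul_ne_zero (mul_ne_zero (mul_ne_zero hα0 hβ0) hA0) hB0
  set C : K := y / (α * β * A * B) with hC
  have hC0 : C ≠ 0 := div_ne_zero hy hden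
  have hCy : C * (α * β * A * B) = y := div_mul_cancel₀ _ hden
  obtain ⟨jC, rC, hCq⟩ := exists_locQ (ρ := ρ) hC0
  have hx3 : x - 3 = α * β * C ^ 2 := by
    have key : α * β * C ^ 2 * (x * (x + 2)) = (x - 3) * (x * (x + 2)) := by
      calc α * β * C ^ 2 * (x * (x + 2)) = (C * (α * β * A * B)) ^ 2 := by rw [hx2, hx]; ring
        _ = (x - 3) * (x * (x + 2)) := by rw [hCy, hE]; ring
    exact (mul_right_cancel₀ (mul_ne_zero hx0 hx20) key).symm
  refine ⟨jA, jB, jC, ?_, ?_, ?_⟩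
  · have h := hα.mul hA.sq
    rw [mul_one] at h
    rwa [hx]
  · have h := hβ.mul hB.sq
    rw [mul_one] at h
    rwa [hx2]
  · have h := (hα.mul hβ).mul hCq.sq
    rw [mul_one] at h
    rwa [hx3]

/-- `2⁻ᵏ · 2ᵏ = 1` in `K` (`k : ℕ`). [folklore] -/
theorem two_zpow_neg_mul_pow (k : ℕ) : (2 : K) ^ (-(k : ℤ)) * (2 : K) ^ k = 1 := by
  rw [zpow_neg, zpow_natCast, inv_mul_cancel₀ (pow_ne_zero k two_ne_zero_K)]

/-- **Case `ord(x) < 0`.** [folklore] -/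
theorem localImage_neg {n₁ n₂ n₃ : ℤ} {X₁ X₂ X₃ : K} (h₁ : LocU ρ X₁ ra) (h₂ : LocU ρ X₂ rb)
    (h₃ : LocU ρ X₃ (ra * rb)) (E1 : (2 : K) ^ n₂ * X₂ = (2 : K) ^ n₁ * X₁ + 2)
    (E2 : (2 : K) ^ n₃ * X₃ = (2 : K) ^ n₁ * X₁ - 3) (hn : n₁ < 0) :
    n₂ = n₁ ∧ n₃ = n₁ ∧ ((n₁ = -2 ∧ rb = ra + 2 ^ 3 ∧ ra * rb = ra - 3 * 4 ^ 1) ∨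
      (n₁ ≤ -4 ∧ rb = ra + 0 ∧ ra * rb = ra - 3 * 0) ∨ n₁ % 2 ≠ 0) := by
  obtain ⟨k, hk⟩ : ∃ k : ℕ, n₁ = -(k : ℤ) := ⟨(-n₁).toNat, by omega⟩
  have hk1 : 1 ≤ k := by omega
  subst hk
  -- (E2): 2^{n₃} X₃ = 2^{-k} (X₁ - 3·2^k)
  have hkk := two_zpow_neg_mul_pow (K := K) k
  have E2' : (2 : K) ^ n₃ * X₃ = (2 : K) ^ (-(k : ℤ)) * (X₁ - 3 * (2 : K) ^ k) := by
    linear_combination E2 + 3 * hkk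
  have hI3 : LocI ρ (X₁ - 3 * (2 : K) ^ k) (ra - 3 * 2 ^ k) :=
    h₁.locI.sub ((locI_natCast 3).mul (locI_two_pow k))
  have hU3 : LocU ρ (X₁ - 3 * (2 : K) ^ k) (ra - 3 * 2 ^ k) := by
    refine hI3.locU ?_
    rw [two_pow_eq_two_mul hk1]
    exact isOdd_sub_three_mul_two_mul _ _ h₁.isOdd
  obtain ⟨hn3, hr3⟩ := h₃.exp_unique hU3 E2'
  -- (E1): 2^{n₂} X₂ = 2^{-k} (X₁ + 2^{k+1})
  have E1' : (2 : K) ^ n₂ * X₂ = (2 : K) ^ (-(k : ℤ)) * (X₁ + (2 : K) ^ (k + 1)) := by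
    rw [pow_succ]
    linear_combination E1 - 2 * hkk
  have hI2 : LocI ρ (X₁ + (2 : K) ^ (k + 1)) (ra + 2 ^ (k + 1)) := h₁.locI.add (locI_two_pow (k + 1))
  have hU2 : LocU ρ (X₁ + (2 : K) ^ (k + 1)) (ra + 2 ^ (k + 1)) := by
    refine hI2.locU ?_
    rw [pow_succ, mul_comm]
    exact isOdd_add_two_mul _ _ h₁.isOdd
  obtain ⟨hn2, hr2⟩ := h₂.exp_unique hU2 E1'
  refine ⟨hn2, hn3, ?_⟩
  rcases Nat.lt_or_ge k 4 with hk4 | hk4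
  · interval_cases k
    · exact Or.inr (Or.inr (by omega))
    · refine Or.inl ⟨by omega, ?_, ?_⟩
      · rw [hr2]
      · rw [hr3]; ring
    · exact Or.inr (Or.inr (by omega))
  · refine Or.inr (Or.inl ⟨by omega, ?_, ?_⟩)
    · rw [hr2, two_pow_eq_zero (by omega)]
    · rw [hr3, show (2 : ZMod 8) ^ k = 0 from two_pow_eq_zero (by omega)]

/-- **Case `ord(x) = 0`.** [folklore] -/
theorem localImage_zero {n₂ n₃ : ℤ} {X₁ X₂ X₃ : K} (h₁ : LocU ρ X₁ ra) (h₂ : LocU ρ X₂ rb)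
    (h₃ : LocU ρ X₃ (ra * rb)) (E1 : (2 : K) ^ n₂ * X₂ = X₁ + 2) (E2 : (2 : K) ^ n₃ * X₃ = X₁ - 3)
    (hn3 : n₃ % 2 = 0) :
    n₂ = 0 ∧ rb = ra + 2 ∧ ((ra - 3 = 2 ^ 2 * (ra * rb)) ∨ (ra - 3 = 0 * (ra * rb))) := by
  -- (E1)
  have hU2 : LocU ρ (X₁ + 2) (ra + 2) := by
    refine (h₁.locI.add ?_).locU ?_
    · simpa using locI_natCast (ρ := ρ) 2
    · simpa using isOdd_add_two_mul ra 1 h₁.isOdd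
  obtain ⟨hn2, hr2⟩ := h₂.exp_unique hU2 (m := n₂) (m' := 0) (by rw [zpow_zero, one_mul, E1])
  refine ⟨hn2, hr2, ?_⟩
  have hI : LocI ρ (X₁ - 3) (ra - 3) := by simpa using h₁.locI.sub (locI_natCast (ρ := ρ) 3)
  -- n₃ ≥ 2
  have hn3' : 2 ≤ n₃ := by
    by_contra hlt
    have hle : n₃ ≤ 0 := by omega
    obtain ⟨k, hk⟩ : ∃ k : ℕ, n₃ = -(k : ℤ) := ⟨(-n₃).toNat, by omega⟩
    have hX3 : X₃ = (2 : K) ^ k * (X₁ - 3) := by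
      rw [← E2, hk, ← mul_assoc, ← zpow_natCast, ← zpow_add₀ two_ne_zero_K, add_neg_cancel, zpow_zero,
        one_mul]
    have hI3 : LocI ρ X₃ (2 ^ k * (ra - 3)) := by rw [hX3]; exact (locI_two_pow k).mul hI
    exact odd_mul_ne_mul_sub_three _ _ _ h₁.isOdd h₂.isOdd (h₃.locI.unique hI3)
  obtain ⟨k, hk⟩ : ∃ k : ℕ, n₃ = k := ⟨n₃.toNat, by omega⟩
  have hk2 : 2 ≤ k := by omega
  have hI' : LocI ρ (X₁ - 3) (2 ^ k * (ra * rb)) := by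
    rw [← E2, hk, zpow_natCast]; exact (locI_two_pow k).mul h₃.locI
  have hr := hI.unique hI'
  rcases Nat.lt_or_ge k 3 with hk3 | hk3
  · obtain rfl : k = 2 := by omega
    exact Or.inl hr
  · rw [two_pow_eq_zero hk3] at hr
    exact Or.inr hr

/-- **Case `ord(x) ≥ 2`.** [folklore] -/
theorem localImage_two {n₁ n₂ n₃ : ℤ} {X₁ X₂ X₃ : K} (h₁ : LocU ρ X₁ ra) (h₂ : LocU ρ X₂ rb)
    (h₃ : LocU ρ X₃ (ra * rb)) (E1 : (2 : K) ^ n₂ * X₂ = (2 : K) ^ n₁ * X₁ + 2)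
    (E2 : (2 : K) ^ n₃ * X₃ = (2 : K) ^ n₁ * X₁ - 3) (hn : 2 ≤ n₁) :
    n₂ = 1 ∧ n₃ = 0 ∧ ((n₁ = 3 ∧ rb = 2 ^ 2 * ra + 1 ∧ ra * rb = 2 ^ 3 * ra - 3) ∨
      (4 ≤ n₁ ∧ rb = 0 * ra + 1 ∧ ra * rb = 0 * ra - 3) ∨ n₁ = 2) := by
  obtain ⟨k, hk⟩ : ∃ k : ℕ, n₁ = k := ⟨n₁.toNat, by omega⟩
  have hk2 : 2 ≤ k := by omega
  subst hk
  rw [zpow_natCast] at E1 E2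
  -- (E2): odd
  have hU3 : LocU ρ ((2 : K) ^ k * X₁ - 3) (2 ^ k * ra - 3) := by
    refine (((locI_two_pow k).mul h₁.locI).sub ?_).locU ?_
    · simpa using locI_natCast (ρ := ρ) 3
    · rw [two_pow_eq_two_mul (by omega : 1 ≤ k)]
      exact isOdd_two_mul_sub_three ra _
  obtain ⟨hn3, hr3⟩ := h₃.exp_unique hU3 (m := n₃) (m' := 0) (by rw [zpow_zero, one_mul, E2])
  -- (E1): 2^{n₂} X₂ = 2 (2^{k-1} X₁ + 1)
  obtain ⟨k', rfl⟩ : ∃ k', k = k' + 1 := ⟨k - 1, by omega⟩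
  have E1' : (2 : K) ^ n₂ * X₂ = (2 : K) ^ (1 : ℤ) * ((2 : K) ^ k' * X₁ + 1) := by
    rw [E1, zpow_one, pow_succ]; ring
  have hU2 : LocU ρ ((2 : K) ^ k' * X₁ + 1) (2 ^ k' * ra + 1) := by
    refine (((locI_two_pow k').mul h₁.locI).add ?_).locU ?_
    · simpa using locI_natCast (ρ := ρ) 1
    · rw [two_pow_eq_two_mul (by omega : 1 ≤ k')]
      exact isOdd_two_mul_add_one ra _
  obtain ⟨hn2, hr2⟩ := h₂.exp_unique hU2 E1'
  refine ⟨hn2, hn3, ?_⟩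
  rcases Nat.lt_or_ge k' 3 with hk3 | hk3
  · interval_cases k'
    · exfalso; omega
    · exact Or.inr (Or.inr (by omega))
    · exact Or.inl ⟨by omega, hr2, by simpa using hr3⟩
  · refine Or.inr (Or.inl ⟨by omega, ?_, ?_⟩)
    · rw [hr2, two_pow_eq_zero hk3]
    · rw [hr3, two_pow_eq_zero (by omega)]

/-- **Case `ord(x) = 1`.** [folklore] -/
theorem localImage_one {n₂ n₃ : ℤ} {X₁ X₂ X₃ : K} (h₁ : LocU ρ X₁ ra) (h₂ : LocU ρ X₂ rb)
    (h₃ : LocU ρ X₃ (ra * rb)) (E1 : (2 : K) ^ n₂ * X₂ = 2 * X₁ + 2) (E2 : (2 : K) ^ n₃ * X₃ = 2 * X₁ - 3)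
    (hn2 : n₂ % 2 = 1) :
    n₃ = 0 ∧ ra * rb = 2 * ra - 3 ∧ ((ra + 1 = 2 ^ 2 * rb) ∨ (ra + 1 = 0 * rb)) := by
  have hU3 : LocU ρ (2 * X₁ - 3) (2 * ra - 3) := by
    refine ((?_ : LocI ρ (2 * X₁) (2 * ra)).sub ?_).locU ?_
    · simpa using (locI_natCast (ρ := ρ) 2).mul h₁.locI
    · simpa using locI_natCast (ρ := ρ) 3
    · simpa using isOdd_two_mul_sub_three ra 1
  obtain ⟨hn3, hr3⟩ := h₃.exp_unique hU3 (m := n₃) (m' := 0) (by rw [zpow_zero, one_mul, E2])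
  refine ⟨hn3, hr3, ?_⟩
  have hI : LocI ρ (X₁ + 1) (ra + 1) := by simpa using h₁.locI.add (locI_natCast (ρ := ρ) 1)
  have E1' : (2 : K) ^ (n₂ - 1) * X₂ = X₁ + 1 := by
    apply mul_left_cancel₀ two_ne_zero_K
    rw [← mul_assoc, ← zpow_one_add₀ two_ne_zero_K, add_sub_cancel, E1]; ring
  -- n₂ ≥ 3
  have hn2' : 3 ≤ n₂ := by
    by_contra hlt
    have hle : n₂ - 1 ≤ 0 := by omega
    obtain ⟨k, hk⟩ : ∃ k : ℕ, n₂ - 1 = -(k : ℤ) := ⟨(1 - n₂).toNat, by omega⟩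
    have hX2 : X₂ = (2 : K) ^ k * (X₁ + 1) := by
      rw [← E1', hk, ← mul_assoc, ← zpow_natCast, ← zpow_add₀ two_ne_zero_K, add_neg_cancel, zpow_zero,
        one_mul]
    have hI2 : LocI ρ X₂ (2 ^ k * (ra + 1)) := by rw [hX2]; exact (locI_two_pow k).mul hI
    exact odd_ne_mul_add_one _ _ _ h₁.isOdd h₂.isOdd (h₂.locI.unique hI2)
  obtain ⟨k, hk⟩ : ∃ k : ℕ, n₂ - 1 = k := ⟨(n₂ - 1).toNat, by omega⟩
  have hk2 : 2 ≤ k := by omega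
  have hI' : LocI ρ (X₁ + 1) (2 ^ k * rb) := by
    rw [← E1', hk, zpow_natCast]; exact (locI_two_pow k).mul h₂.locI
  have hr := hI.unique hI'
  rcases Nat.lt_or_ge k 3 with hk3 | hk3
  · obtain rfl : k = 2 := by omega
    exact Or.inl hr
  · rw [two_pow_eq_zero hk3] at hr
    exact Or.inr hr

/-- **The local image of the `2`-descent map of `480a1` at an unramified degree-one prime above
`2`.** Let `(x, y)`, `y ≠ 0`, be a `K`-point of `y² = x(x + 2)(x - 3)` and `x = α A²`,
`x + 2 = β B²` with `α` of class `(a, rα)` and `β` of class `(b, rβ)` at `𝔭_ρ`. Then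
`(a mod 2, rα; b mod 2, rβ) ∈ W` (`W480`). [cite: SilvermanAEC2009, Prop. X.1.4] -/
theorem localImage (hE : y ^ 2 = x * (x + 2) * (x - 3)) (hy : y ≠ 0) (hx : x = α * A ^ 2)
    (hx2 : x + 2 = β * B ^ 2) (hα : LocQ ρ α a ra) (hβ : LocQ ρ β b rb) : W480 a b ra rb := by
  obtain ⟨jA, jB, jC, q₁, q₂, q₃⟩ := exists_classes hE hy hx hx2 hα hβ
  have hra : IsOdd ra := hα.isOdd
  have hrb : IsOdd rb := hβ.isOdd
  obtain ⟨X₁, h₁, e₁⟩ := q₁.exists_eq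
  obtain ⟨X₂, h₂, e₂⟩ := q₂.exists_eq
  obtain ⟨X₃, h₃, e₃⟩ := q₃.exists_eq
  set n₁ := a + 2 * jA with hn₁
  set n₂ := b + 2 * jB with hn₂
  set n₃ := a + b + 2 * jC with hn₃
  have E1 : (2 : K) ^ n₂ * X₂ = (2 : K) ^ n₁ * X₁ + 2 := by rw [← e₁, ← e₂]
  have E2 : (2 : K) ^ n₃ * X₃ = (2 : K) ^ n₁ * X₁ - 3 := by rw [← e₁, ← e₃]
  rcases lt_trichotomy n₁ 0 with hneg | hzero | hpos
  · -- ord(x) < 0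
    obtain ⟨hn2, hn3, hcases⟩ := localImage_neg h₁ h₂ h₃ E1 E2 hneg
    have ha : a % 2 = 0 := by omega
    have hb : b % 2 = 0 := by omega
    rcases hcases with ⟨-, hr2, hr3⟩ | ⟨-, hr2, hr3⟩ | hodd
    · exact Or.inl ⟨ha, hb, W_case_neg_one ra rb hra hr2 hr3⟩
    · exact Or.inl ⟨ha, hb, W_case_neg_two ra rb hra hr2 hr3⟩
    · exact absurd (by omega : n₁ % 2 = 0) hodd
  · -- ord(x) = 0
    rw [hzero, zpow_zero, one_mul] at E1 E2
    have hn3e : n₃ % 2 = 0 ∨ n₃ % 2 = 1 := by omega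
    rcases hn3e with hn3e | hn3o
    · obtain ⟨hn2, hr2, hcases⟩ := localImage_zero h₁ h₂ h₃ E1 E2 hn3e
      have ha : a % 2 = 0 := by omega
      have hb : b % 2 = 0 := by omega
      rcases hcases with hr3 | hr3
      · exact Or.inl ⟨ha, hb, W_case_zero_two ra rb hra hrb hr2 hr3⟩
      · exact Or.inl ⟨ha, hb, W_case_zero_three ra rb hra hr2 hr3⟩
    · -- parity contradiction: n₂ = 0 forces b even, a even, so n₃ even
      exfalso
      have hU2 : LocU ρ (X₁ + 2) (ra + 2) := by
        refine (h₁.locI.add ?_).locU ?_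
        · simpa using locI_natCast (ρ := ρ) 2
        · simpa using isOdd_add_two_mul ra 1 hra
      obtain ⟨hn2, -⟩ := h₂.exp_unique hU2 (m := n₂) (m' := 0) (by rw [zpow_zero, one_mul, E1])
      omega
  · rcases lt_or_ge n₁ 2 with hone | htwo
    · -- ord(x) = 1
      have hn1 : n₁ = 1 := by omega
      rw [hn1, zpow_one] at E1 E2
      have hn2o : n₂ % 2 = 1 ∨ n₂ % 2 = 0 := by omega
      rcases hn2o with hn2o | hn2e
      · obtain ⟨hn3, hr3, hcases⟩ := localImage_one h₁ h₂ h₃ E1 E2 hn2o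
        have ha : a % 2 = 1 := by omega
        have hb : b % 2 = 1 := by omega
        rcases hcases with hr2 | hr2
        · exact Or.inr ⟨ha, hb, W_case_one_two ra rb hra hrb hr3 hr2⟩
        · exact Or.inr ⟨ha, hb, W_case_one_three ra rb hra hrb hr3 hr2⟩
      · exfalso
        have hU3 : LocU ρ (2 * X₁ - 3) (2 * ra - 3) := by
          refine ((?_ : LocI ρ (2 * X₁) (2 * ra)).sub ?_).locU ?_
          · simpa using (locI_natCast (ρ := ρ) 2).mul h₁.locI
          · simpa using locI_natCast (ρ := ρ) 3
          · simpa using isOdd_two_mul_sub_three ra 1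
        obtain ⟨hn3, -⟩ := h₃.exp_unique hU3 (m := n₃) (m' := 0) (by rw [zpow_zero, one_mul, E2])
        omega
    · -- ord(x) ≥ 2
      obtain ⟨hn2, hn3, hcases⟩ := localImage_two h₁ h₂ h₃ E1 E2 htwo
      have hb : b % 2 = 1 := by omega
      have ha : a % 2 = 1 := by omega
      rcases hcases with ⟨-, hr2, hr3⟩ | ⟨-, hr2, hr3⟩ | htwo'
      · exact Or.inr ⟨ha, hb, W_case_three ra rb hra hr2 hr3⟩
      · exact Or.inr ⟨ha, hb, W_case_four ra rb hra hr2 hr3⟩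
      · exfalso; omega

end LocalImage

end Mod8Prime

end Literature.NumberTheory.EllipticCurves

end
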